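import Mathlib
import HarnessLib
import HarnessLib.Audit
import Summits.KontsevichZagierPeriods.Statement
import Literature.NumberTheory.Transcendental.KZCalculusProofs
import Literature.Barriers.KontsevichZagierPeriods.HauptvermutungObstruction
import HarnessLib.Audit.Status.Attr

/-!
Route: ScissorsTransport

Thesis X — VOLUME IS THE ONLY INVARIANT (card newton-leibniz-is-a-shear, in its STABILISED SET
form). It suffices to show
StableSetTransport: for any two integral representations r, r′ of one dimension N with integrand 1 —
i.e. two ℚ-semialgebraic sets
of finite volume (unequal dimensions are first equalised by slabs, a move) — with equal value, there
is M such that, after multiplying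
both domains by the cube [0,1]^M and discarding null ℚ-semialgebraic subsets, ONE instance of rule
(2) carries one onto the other:
a ℚ-semialgebraic map, injective and differentiable within its (open-pieced) domain with |det| = 1 —
a curved scissors congruence by
Jacobian-1 Nash pieces — so that `KZ.of s − KZ.of s′ ∈ KZ.changeOfVariablesRel`. This is Conjecture
1 in Monge/transport form =
Cresson–Viu-Sos's Problem 2.1 (injectivity of vol on K₀(𝒞SA)) sharpened from "stably
scissors-equivalent" to "one map", which is
the natural statement once Newton–Leibniz is seen to BE a shear (crux NewtonLeibnizElimination: rule
3 ∈ ⟨rules 1a, 1b, 2, padding⟩),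
and made honest by the free dimension M (the same-dimension density form is false in dimension 1:
support DimOneTransportFails).
X ⟺ KontsevichZagierPeriods ∧ StableSAZylev (crux, rank 2); X → summit is the Assembly (difference
of volumes, slabs, gluing, soundness), which FACTORS (rev 1) through the VOLUME FORM — two
integrand-1 representations of one dimension with equal value are KZ-equivalent, the frame item
VolumeForm shared verbatim with routes SphericalSchlafli / HardSphereVirial: X → VolumeForm is ten
lines over the support item CylinderReduction (pointwise: an integrand-1 representation is
KZ-equivalent to any full-measure integrand-1 restriction of its cylinder r.domain × [0,1]^M — M
slab moves and one null removal; provable now), and VolumeForm → KontsevichZagierPeriods is those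
routes' shared Assembly stmt-KontsevichZagierPeriods-3822, reusable verbatim once proved.
Lean: `∀ ⦃N : ℕ⦄ (r r' : Literature.NumberTheory.Transcendental.KZ.IntegralRep N), (∀ x ∈ r.domain,
r.integrand x = 1) → (∀ x ∈ r'.domain, r'.integrand x = 1) → r.value = r'.value → ∃ (M : ℕ) (s s' :
Literature.NumberTheory.Transcendental.KZ.IntegralRep (N + M)), s.domain ⊆ {z | (fun i : Fin N => z
(Fin.castAdd M i)) ∈ r.domain ∧ ∀ j : Fin M, z (Fin.natAdd N j) ∈ Set.Icc (0:ℝ) 1} ∧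
MeasureTheory.volume ({z : Fin (N + M) → ℝ | (fun i : Fin N => z (Fin.castAdd M i)) ∈ r.domain ∧ ∀ j
: Fin M, z (Fin.natAdd N j) ∈ Set.Icc (0:ℝ) 1} \ s.domain) = 0 ∧ s'.domain ⊆ {z | (fun i : Fin N =>
z (Fin.castAdd M i)) ∈ r'.domain ∧ ∀ j : Fin M, z (Fin.natAdd N j) ∈ Set.Icc (0:ℝ) 1} ∧
MeasureTheory.volume ({z : Fin (N + M) → ℝ | (fun i : Fin N => z (Fin.castAdd M i)) ∈ r'.domain ∧ ∀
j : Fin M, z (Fin.natAdd N j) ∈ Set.Icc (0:ℝ) 1} \ s'.domain) = 0 ∧ (∀ z ∈ s.domain, s.integrand z =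
1) ∧ (∀ z ∈ s'.domain, s'.integrand z = 1) ∧ Literature.NumberTheory.Transcendental.KZ.of s -
Literature.NumberTheory.Transcendental.KZ.of s' ∈
Literature.NumberTheory.Transcendental.KZ.changeOfVariablesRel`
Assembly (Lean): `StableSetTransport → KontsevichZagierPeriods` (the rev-0 item spells the
hypothesis out; `example : Assembly = (StableSetTransport → KontsevichZagierPeriods) := rfl`).
Deciding theorem (D-0027 §2.1, rev 1, certified native): `theorem closes (h₁ : StableSetTransport)
(h₂ : Assembly) : KontsevichZagierPeriods := h₂ h₁`. Checked in the planner's Sketch6.lean (rc 0):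
`example (hX : StableSetTransport) (hC : CylinderReduction) : VolumeForm` in ten lines.

Rationale: WHY THIS LINE. Rule 3 of the fixed calculus takes a ℚ-semialgebraic primitive F as INPUT; on each
cylindrical cell where f = ∂ₜF has constant sign the shear Φ(x,t) = (x, F(x,t)) is an admissible
change of variables with |det Φ′| = |f|, a second shear flattens the image to base × (0,1), and the
tree's slab move un-pads — so KZ.relations = ⟨1a, 1b, 2, slabs⟩ (crux NewtonLeibnizElimination): the
H21 calculus IS curved scissors congruence + Jacobian-1 Nash transport + trivial padding,
Cresson–Viu-Sos's K₀(𝒞SA) picture made exact for our rules (CressonViusos2022 §2.2, against their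
§2.1 'can not be achieved' which integrates variables OUT; ViuSos2021 Thm 1.1 supplies the subgraph
reduction = support DifferenceOfVolumes). Once the calculus is scissors congruence, Conjecture 1 has
a MONGE FORM — one map instead of a signed chain — and sixty years of scissors-congruence/transport
technology (Zylev-type cancellation, Hadwiger/Dehn-type invariants, Pak–Henriques–Kuperberg
volume-preserving PL maps, Zakharevich's K-theory of assemblers: Zakharevich2016) bear on it; the
new, transcendence-free question is whether stable equidecomposability compresses to one transport
(crux StableSAZylev). Imported areas: real semialgebraic geometry (BochnakCosteRoy1998: CAD,
piecewise-Nash regularity), scissors congruence / K₀ of cut-and-paste, optimal-transport heuristics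
(Knothe–Rosenblatt maps are semialgebraic iff fibre CDFs are). Unlike every open route (Neg,
LowDimension use the calculus as given;
NoriTransfer/Grothendieck/AyoubSpecialisation/ExpConservative change the period formalism) this line
changes the PRESENTATION of the calculus itself. Two refuter triages (cards
newton-leibniz-is-a-shear, level-pairing-no-transport-dim-one) showed the card's same-dimension
density transport T is FALSE in dimension 1 (log and arcsin obstructions) and that one free
dimension repairs both witnesses; the thesis is therefore filed in the stabilised set form they
recommend, and the failure is recorded as support DimOneTransportFails.
RANKED CRUXES. #2 StableSAZylev — integrand-1 reps that are KZ-EQUIVALENT are, after × [0,1]^M and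
null removal, related by ONE rule-(2) move (why it might fail: cancellation A⊔C ≅ B⊔C ⇒ A ≅ B may
need unboundedly long ping-pong orbits, i.e. infinitely many pieces — only kA ≃ kB ⇒ A ≃ B holds
finitely — and the Larsen–Lunts analogue fails in K₀(Var_ℂ) via zero divisors, Borisov
doi:10.1090/jag/701; sources CressonViusos2022 Problem 2.1/Rem 2.3, Zakharevich2016). Hardest
informative step specific to the line; X ⟺ summit ∧ #2. #3 NewtonLeibnizElimination —
newtonLeibnizRel ⊆ closure(domainAddRel ∪ integrandAddRel ∪ changeOfVariablesRel ∪ {of (r.slab j) −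
of r}) (why it might fail: only through rule (2)'s side conditions — the shear must be C¹ in ALL
variables and injective per open cell, needing a ℚ-semialgebraic C¹ cylindrical decomposition,
BochnakCosteRoy1998 Thm 2.3.1/Prop 2.9.10, absent from Mathlib and present in the tree only as the
named fact exists_contDiffOn; cost ≈ 800–1500 lines, no mathematical doubt; the triage refuter
re-derived it 'no gap'). The mechanism; provable. #4 StableSetTransport — the thesis X itself, Monge
form of Conjecture 1 (why it might fail: at least summit-strength, all strength barriers apply; a
Dehn-type or functional-transcendence invariant of stable piecewise-Nash volume-preserving
equidecomposability finer than volume; Blass–Schanuel call the classification intractable,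
CressonViusos2022 Rem 2.3). Refuter target: an invariant killing X but not KZ-chains refutes #2, not
the summit.
SUPPORT. DifferenceOfVolumes (every rep ≡ [U₊] − [U₋], integrand-1 reps one dimension up; ViuSos2021
Thm 1.1 inside the rules; first half of the Assembly; provable now ≈ 300 lines).
DimOneTransportFails (negative fact: the positive rational pair [(0,1),1] ~ [(1,2), 1+1/x−1/(3−x)]
is KZ-equivalent by 4 moves but admits no single rule-(2) move between full-measure restrictions —
log would be Nash; records that M ≥ 1 is load-bearing). PolytopeTransport (known sector, M = 0:
rational polyhedra of equal volume, Pak/Henriques–Pak via CressonViusos2022 Thm 4.1–4.2; calibration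
of the CoV/null-set bookkeeping and of the Hauptvermutung barrier's recorded evasion; rev 1:
'rational polyhedron' = finite union of rational simplices is INLINED over Mathlib convexHull —
Iff.rfl with the rev-0 text over the barrier file's PL.IsRationalPolyhedron — so the route file no
longer imports Literature.Barriers.KontsevichZagierPeriods.HauptvermutungObstruction, whose XL
unproved fact cressonViuSos_prop_3_2 rode in on that import and blocked staffing; the barrier is
cited by name, never depended on). VolumeForm (rev 1; frame item shared verbatim with routes
SphericalSchlafli / HardSphereVirial, stmt-3814: integrand-1 reps of one dimension with equal value
are KZ-equivalent; formally stronger than the printed KZ.volumeConjectureCompact of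
KZVolumeConjecture.lean; summit-equivalent; the node between X and the summit, filed here to make
the factoring of the Assembly explicit — not a crux of this route). CylinderReduction (rev 1,
pointwise: for an integrand-1 rep r of dimension N and an integrand-1 rep s of dimension N + M whose
domain is a full-measure subset of the cylinder {z | z ∘ castAdd ∈ r.domain, z (natAdd N j) ∈
[0,1]}, KZ.Equivalent r s — the M-fold slab at level 0 IS that cylinder (one Fin identity),
of_slab_sub_of_mem_newtonLeibnizRel M times, null removal by of_sub_of_mem_relations_of_null
(KZSemiCanonicalReductionProofs.lean); provable now ≈ 150–250 lines; with it X → VolumeForm is ten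
lines (changeOfVariablesRel ⊆ relations and group arithmetic; done in the planner's Sketch6.lean)).
Assembly (rank 1; rev-0 text kept — the gate neither drops nor restates an assembly item and refuses
a second summit-concluding item, so the second half VolumeForm → KontsevichZagierPeriods is NOT
re-filed here: it is verbatim the shared Assembly stmt-3822 of SphericalSchlafli / HardSphereVirial,
whose proof, once landed, closes ours with CylinderReduction in a dozen lines): X →
KontsevichZagierPeriods via CylinderReduction, then DifferenceOfVolumes / exists_underGraph, slabs
(IntegralRep.exists_equivalent_of_le), glue (of_glue_sub_sub_mem_domainAddRel,
disjoint_domain_slab_zero_two), soundness (relations_le_ker_eval_holds,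
IntegralRep.value_eq_volume_real); ≈ 400 lines over KZCalculusProofs.lean /
KZSemiCanonicalReductionProofs.lean, no compactification needed (the named fact
KZ.semiCanonicalReduction is unproved in the tree and must not become a hypothesis). Deciding
theorem (rev 1, certified native): closes (h₁ : StableSetTransport) (h₂ : Assembly) :
KontsevichZagierPeriods := h₂ h₁.
TWO-LAYER PLAN. Foreseen after #3 lands: #2 ⇐ GeometricChain → StableCancellation → StableSAZylev,
where GeometricChain says KZ.Equivalent integrand-1 reps are stably scissors-equivalent WITH a
complement (A ⊔ C ≅ B ⊔ C by one move, from #3 + DifferenceOfVolumes + the Grothendieck-group lemma)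
and StableCancellation says A ⊔ C ≅ B ⊔ C ⇒ A × I ≅ B × I by one move (the SA-Zylev/Hilbert-hotel
step). Foreseen under #4: sector children (dimension-2 subgraph sets over Baker-type 1-periods,
jointly with LowDimension 0405; mixed-Tate/Aomoto polytopes in the Klein model, cf. card
scissors-avatars-bloch-aomoto-cells). None filed now.
KILL CRITERIA. A refutation of #4 by a pair that IS KZ-equivalent refutes #2 as well and closes the
route (`close --reason refuted:StableSAZylev`: the Monge form is then strictly stronger than the
calculus and the line has no summit content left beyond #3, which survives as support for
Neg/LowDimension). A refutation of #4 by a pair not known to be KZ-equivalent is a candidate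
refutation of the SUMMIT: pivot to Neg with the invariant. A refutation of #3 would mean a defect in
my reading of changeOfVariablesRel's side conditions: restate with the missing regularity (e.g.
cells where F is only C⁰ in x) — not a kill. #2 proved + #3 proved: the route becomes the canonical
reformulation (X ⟺ summit) and goes dormant-positive unless sector children of #4 move.
NOT DECOMPOSED YET. The K₀ comparison P_KZ ≅ K₀(ℚ-SA measured sets; scissors, Jacobian-1 Nash maps,
flattening) as a Lean object (needs a quotient-monoid definition; deferred until #3 lands, then
filed as a definition request + GeometricChain); the cancellation lemma's combinatorics (bounded
ping-pong on semialgebraic pieces); transport-map regularity criteria (Knothe–Rosenblatt/Brenier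
maps between SA densities are SA iff fibre CDFs are — where transcendence re-enters) for direct
attacks on #4; the explicit M = 1 repair of the two dimension-1 witnesses (prover-level `--supports
DimOneTransportFails`/`StableSAZylev` lemmas); compact vs finite-volume (C–VS work with compact
sets; here finite volume suffices and compactification x ↦ x/(1−x²)-type maps are rule (2)).
CHEAPEST FALSIFIER. (#2) The ASYMMETRIC dimension-1 pair r = [(0,1), 1], r′ = [(1,2), 1 + 1/x −
2x/(x²+2)] (rational, integrand > 0.79, both values 1 since ∫₁² dx/x = ∫₁² 2x dx/(x²+2) = log 2;
KZ-equivalent by ≈ 6 moves: 1b twice, the changes of variables y = x²+2 and y = 3x, zero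
bookkeeping, a translation; NO same-dimension transport by the log obstruction, as for the triage
witness) has, unlike both known witnesses, no reflection symmetry. Its subgraph S and the square Q
satisfy S ⊔ T ≅ Q ⊔ T for T = subgraph(1/x) over (1,2) by explicit shears and the Jacobian-1 lift
(x,u) ↦ (ψ x, u/ψ′ x) of ψ(x) = (x²+2)/3. Run the Zylev/Hilbert-hotel ping-pong S → Q through T and
check whether orbit lengths are bounded (a small kit computation on an explicit semialgebraic
partial self-map of T, or by hand): bounded ⇒ an explicit M = 1 one-move transport and the first
asymmetric evidence for #2; unbounded ⇒ naive compression fails and #2 needs a new idea (or is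
false) — either way the pair is the first child test of #2. (#3) Re-derive the n = 0 case (NL
through dimension 0 = shear + flatten + one slab) against KZCalculus.lean's exact side conditions —
done on paper by the triage refuter, no gap. (#4) beyond #2's test, only an invariant can falsify;
the obvious candidates (boundary data of the cut loci, o-minimal Euler characteristics) die modulo
null sets and free re-cutting — no cheaper falsifier known.
SOURCES. KontsevichZagier2001 §1.1–1.2; CressonViusos2022 (arXiv:1912.01751) §2.1–2.2, Problem 2.1,
Rem 2.3, Thm 4.1–4.4; ViuSos2021 (arXiv:1509.01097) Thm 1.1; BochnakCosteRoy1998 §2.3, §2.9;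
Zakharevich2016; Borisov doi:10.1090/jag/701; Kuperberg doi:10.1007/bf02566410; Ayoub2015 Rem 1.5 /
Fresan2024 Rem 3.7 (converse direction: rule 2 from Stokes); tree: KZCalculus.lean,
KZCalculusProofs.lean, KZVolumeConjecture.lean (+Proofs), KZSemiCanonicalReductionProofs.lean,
SemialgebraicMapsProofs.lean, TarskiSeidenbergProofs.lean,
Literature/Barriers/KontsevichZagierPeriods/{AlgebraicPrimitivesObstruction,HauptvermutungObstruction}.lean
(the latter cited, no longer imported); sibling routes SphericalSchlafli / HardSphereVirial (shared
VolumeForm stmt-3814, Assembly stmt-3822); hub triage notes on cards newton-leibniz-is-a-shear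
(refuter-1, 2026-08-15T04:06Z) and level-pairing-no-transport-dim-one (refuter-13, 06:14Z).
DEFINITION REQUESTS. None (all nine statements elaborate over existing declarations — rev 1 over
Mathlib + KZCalculus/KZCalculusProofs only; the K₀ object is deferred, see NOT DECOMPOSED YET).
DEGENERATE CASES CHECKED. N = 0 (domains ∅/{pt}: transport trivial, 0 ∈ changeOfVariablesRel via Φ =
id); s = s′ allowed only when the two cylinders agree mod null (then of s − of s = 0 ∈ CoV,
correct); equal value ⟺ equal volume for integrand-1 reps (finite by integrability); pieces of
s.domain open ⇒ HasFDerivWithinAt is local, cuts cost nothing; integrand-1 reps are IsRational (p =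
q = 1), so summit ∧ #2 ⇒ #4; dimension-1 integrand-1 case of #4 is trivial with M = 0 (algebraic
interval lengths), the dimension-1 DENSITY case is exactly where M = 1 is needed
(DimOneTransportFails).

Novelty: Searches (2026-08-15): `lit frontier KontsevichZagierPeriods --since 2020` (30 descendants; none on
scissors congruence/semialgebraic transport), `lit bridges KontsevichZagierPeriods --cross any` (30;
none relevant), `lit search --hybrid "semialgebraic sets equal volume volume-preserving
semialgebraic bijection scissors congruence"` (10 held docs, nearest van den Dries 1998 o-minimal
generalities), `lit search --hybrid "Zylev equicomplementable equidecomposable polyhedra"`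
(Aigner–Ziegler, Lützen: Hilbert 3 history only), `lit search --hybrid "Moser theorem volume forms
Nash manifolds semialgebraic diffeomorphism"` (nothing SA-specific), `lit galaxy search "scissors
congruence" --star all` (24 rows: Campbell–Zakharevich arXiv:1910.07112, Dehn–Sydler expositions,
Hesselholt notes — K-theory of polytopes, not SA sets), crossref lookups (Borisov
doi:10.1090/jag/701, Kuperberg doi:10.1007/bf02566410, Larsen–Lunts
doi:10.17323/1609-4514-2003-3-1-85-95), `lit read arxiv:1912.01751` pp. 3–5, 8–9 (CressonViusos2022)
and the two hub triage notes on cards newton-leibniz-is-a-shear /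
level-pairing-no-transport-dim-one; all 123 cards of the sub via `ledger idea list` (related:
scissors-avatars-bloch-aomoto-cells = NL-free SUB-calculi on Aomoto polytopes,
archimedean-ordered-k0 / inequalities-are-accessible (merged/retired) = ORDER structure of P_KZ;
neither eliminates rule 3 or states a transport form).
Nearest prior art found: CressonViusos2022 (arXiv:1912.01751) §2.1–2.2 — K₀(𝒞SA) of c  [refs: 10.1090/jag/701, 10.1007/bf02566410, 10.17323/1609-4514-2003-3-1-85-95, 1910.07112, 1912.01751, doi:10.1090/jag/701, doi:10.1007/bf02566410, doi:10.17323/1609-4514-2003-3-1-85-95, arxiv:1912.01751, CressonViusos2022, ViuSos2021, Ayoub2015, Fresan2024, Zakharevich2016]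

Barriers (technique_class: scissors-congruence semialgebraic-transport rule-elimination): - technique_class: scissors-congruence semialgebraic-transport rule-elimination
- Literature.Barriers.KontsevichZagierPeriods.noSemialgebraicPrimitive_inv_sub_two: EVADED — the
barrier (AlgebraicPrimitivesObstruction: ∫₀¹ dt/(t−2) has no ℚ-semialgebraic primitive, so
'integrate a variable out by Fubini + Newton–Leibniz' fails) blocks strategies that must PRODUCE a
primitive; here rule 3's primitive is input data and is converted into the shear (x, F(x,t)); no
variable is ever integrated out, and the thesis quantifies over all dimensions (no 'fixed number of
variables').
- Literature.Barriers.KontsevichZagierPeriods.cressonViuSos_prop_3_2: EVADED by the barrier's own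
recorded evasion 'keep the dissection' — Prop. 3.2 (Hauptvermutung) kills ONE GLOBAL scissors-free
semialgebraic/PL homeomorphism between homeomorphic non-PL-homeomorphic polyhedral representations
(dimension ≥ 5); StableSetTransport asks for one rule-(2) move on a domain with finitely many OPEN
semialgebraic pieces modulo null cut loci (no global homeomorphism, no continuity across cuts),
exactly scissors congruence + cellwise maps; PolytopeTransport (support) is the polytope sector
where this is a theorem (C–VS Thm 4.1).
- Literature.Barriers.KontsevichZagierPeriods.kzConjecture_implies_oddZetaAlgIndep: NOT evaded —
StableSetTransport implies the summit, hence ζ(5) ∉ ℚ etc.; the bet is structural: #3 is an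
unconditional simplification of the calculus, #2 is transcendence-free (it compares two equivalence
relatio

History (route lifecycle, newest last):
- 2026-08-15T16:24:28Z · rev 1: restated PolytopeTransport (stmt-KontsevichZagierPeriods-2672) — route-repair rev 1a (cone guardrail + D-0027 glue): imports := [KZCalculusProofs] — drop Literature.Barriers.KontsevichZagierPeriods.HauptvermutungObstruction ( (planner-rbadge-KontsevichZagierPeriods-Scissor-31e79734-g2-0)
- 2026-08-16T14:43:06Z · LINT AUTOFIX route.multi-assembly: kept Assembly, dropped Assembly2 (gate:hygiene)
- 2026-08-23T23:59:08Z · DORMANT — reconciler: no traction for 6.4 d (last activity item-evidence-added at 2026-08-17T14:49:18Z); parked, not closed — `ledger route dormant route-KontsevichZagier (operator:999:265499)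
- 2026-08-31T08:39:45Z · REACTIVATED (open) — reconciler: reactivated — activity statement-checked at 2026-08-31T07:27:55Z after parking at 2026-08-23T23:59:08Z (operator:999:694726)

sub-problem: KontsevichZagierPeriods · status: open · opened planner-plancard-KontsevichZagierPeriods-Kont-c581d2d6-0 2026-08-15T11:06:47Z · rev 4 · ledger route-KontsevichZagierPeriods-ScissorsTransport
GENERATED by the gate from the ledger (D-0016/17). Provers cite these decls: `theorem foo : Summit.KontsevichZagierPeriods.KontsevichZagierPeriods.Theses.ScissorsTransport.<Decl> := …` in Summits/KontsevichZagierPeriods/KontsevichZagierPeriods/Theorems/<Name>.lean.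
-/

namespace Summit.KontsevichZagierPeriods.KontsevichZagierPeriods.Theses.ScissorsTransport

open scoped BigOperators Topology Manifold Classical MeasureTheory ProbabilityTheory Matrix InnerProductSpace ComplexConjugate ContinuousMap
open Filter Set Function TopologicalSpace MeasureTheory

attribute [summit_statement] _root_.KontsevichZagierPeriods

open Literature Periods

/-- item stmt-KontsevichZagierPeriods-2667 · crux · rank 2 · open · by planner
why it might fail: Cancellation A⊔C≅B⊔C ⇒ A×I≅B×I may need unboundedly long ping-pong orbits through C (infinitely many pieces; finitely only kA≃kB⇒A≃B holds); the Larsen–Lunts analogue fails in K0(Var) via zero divisors (Borisov); M=0 is false in dim 1 for densities.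
sources: CressonViusos2022, Zakharevich2016, doi:10.1090/jag/701, ViuSos2021, KontsevichZagier2001
[crux] STABLE SEMIALGEBRAIC ZYLEV. For integrand-1 representations r, r′ of one dimension N (=
ℚ-semialgebraic sets A, B of finite volume): if they are KZ-EQUIVALENT (a signed chain of moves
through any dimensions and densities), then after multiplying both by a cube [0,1]^M (cylinder over
castAdd/natAdd coordinates = iterated IntegralRep.slab at level 0) and discarding null
ℚ-semialgebraic subsets, ONE instance of rule (2) carries one onto the other (`of s − of s′ ∈
changeOfVariablesRel`: pieces of s.domain need only be open and the map injective across pieces, so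
'one move' = curved scissors congruence with Jacobian-1 Nash maps). Transcendence-free: it compares
two equivalence relations inside the calculus; StableSetTransport ⟹ this (soundness,
`Equivalent.value_eq_holds`; checked in Sketch.lean) and KontsevichZagierPeriods ∧ this ⟹
StableSetTransport (integrand-1 reps are IsRational with p = q = 1), so the thesis ⟺ summit ∧
StableSAZylev. Intended proof shape (layer 2, after NewtonLeibnizElimination): (i) every move
becomes geometric on subgraph sets (cut/paste, transport, padding), so Equivalent ⟹ [A] = [B] in K₀
of the monoid of ℚ-SA finite-volume sets mod null under piecewise -/
@[route_item "route-KontsevichZagierPeriods-ScissorsTransport"]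
def StableSAZylev : Prop :=
  ∀ ⦃N : ℕ⦄ (r r' : Literature.NumberTheory.Transcendental.KZ.IntegralRep N), (∀ x ∈ r.domain, r.integrand x = 1) → (∀ x ∈ r'.domain, r'.integrand x = 1) → Literature.NumberTheory.Transcendental.KZ.Equivalent r r' → ∃ (M : ℕ) (s s' : Literature.NumberTheory.Transcendental.KZ.IntegralRep (N + M)), s.domain ⊆ {z | (fun i : Fin N => z (Fin.castAdd M i)) ∈ r.domain ∧ ∀ j : Fin M, z (Fin.natAdd N j) ∈ Set.Icc (0:ℝ) 1} ∧ MeasureTheory.volume ({z : Fin (N + M) → ℝ | (fun i : Fin N => z (Fin.castAdd M i)) ∈ r.domain ∧ ∀ j : Fin M, z (Fin.natAdd N j) ∈ Set.Icc (0:ℝ) 1} \ s.domain) = 0 ∧ s'.domain ⊆ {z | (fun i : Fin N => z (Fin.castAdd M i)) ∈ r'.domain ∧ ∀ j : Fin M, z (Fin.natAdd N j) ∈ Set.Icc (0:ℝ) 1} ∧ MeasureTheory.volume ({z : Fin (N + M) → ℝ | (fun i : Fin N => z (Fin.castAdd M i)) ∈ r'.domain ∧ ∀ j : Fin M, z (Fin.natAdd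 N j) ∈ Set.Icc (0:ℝ) 1} \ s'.domain) = 0 ∧ (∀ z ∈ s.domain, s.integrand z = 1) ∧ (∀ z ∈ s'.domain, s'.integrand z = 1) ∧ Literature.NumberTheory.Transcendental.KZ.of s - Literature.NumberTheory.Transcendental.KZ.of s' ∈ Literature.NumberTheory.Transcendental.KZ.changeOfVariablesRel

/-- item stmt-KontsevichZagierPeriods-2668 · crux · rank 3 · open · by planner
why it might fail: Only via rule (2)'s side conditions: the shear (x,F(x,t)) must be C¹ in ALL variables and injective on each open cell, needing a ℚ-semialgebraic C¹ cylindrical decomposition (BCR 2.3.1/2.9.10) absent from Mathlib (tree: exists_contDiffOn is a named fact only) — cost, not doubt.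
sources: BochnakCosteRoy1998, ViuSos2021, CressonViusos2022, Ayoub2015, KontsevichZagier2001
[crux] NEWTON–LEIBNIZ IS A SHEAR. Every instance of rule (3) lies in the subgroup generated by rules
(1a), (1b), (2) and PADDING `of (r.slab j) − of r` ([σ×[j,j+1], f∘init] − [σ,f], the tree's
IntegralRep.slab, itself one NL move: of_slab_sub_of_mem_newtonLeibnizRel); hence KZ.relations =
closure(1a ∪ 1b ∪ 2 ∪ slabs) — the only dimension change the calculus needs is trivial padding,
everything else is curved scissors + Jacobian transport (rules 1a, 1b, 2 are homogeneous in
dimension, so some padding is necessary: the statement is sharp). Paper proof (re-derived by the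
triage refuter vs KZCalculus.lean, 'no gap'): ℚ-cylindrical cell decomposition of the band adapted
to τ, a, b, sign f (f = ∂ₜF = r.integrand) and the C^∞-locus of F (BCR Thm 2.3.1, Prop 2.9.10);
lower-dimensional cells are null ([r|null] ≡ 0 by 1a: σ = σ ∪ σ); on a top cell C = {x ∈ τᵢ, cⱼ x <
t < cⱼ₊₁ x} with f > 0 (resp. < 0) the shear Φ(x,t) = (x, F(x,t)) is ℚ-semialgebraic, injective, C¹
on the open cell with |det Φ′| = |f|, so [C, f] − [Φ C, ±1] ∈ changeOfVariablesRel; the second shear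
u ↦ (u − F(x,cⱼ x))/(F(x,cⱼ₊₁ x) − F(x,cⱼ x)) (after refining τ so these base functions are C¹)
flattens Φ C to τᵢ × (0,1) with i -/
@[route_item "route-KontsevichZagierPeriods-ScissorsTransport"]
def NewtonLeibnizElimination : Prop :=
  ∀ c ∈ Literature.NumberTheory.Transcendental.KZ.newtonLeibnizRel, c ∈ AddSubgroup.closure (Literature.NumberTheory.Transcendental.KZ.domainAddRel ∪ Literature.NumberTheory.Transcendental.KZ.integrandAddRel ∪ Literature.NumberTheory.Transcendental.KZ.changeOfVariablesRel ∪ {c | ∃ (n : ℕ) (r : Literature.NumberTheory.Transcendental.KZ.IntegralRep n) (j : ℕ), c = Literature.NumberTheory.Transcendental.KZ.of (r.slab j) - Literature.NumberTheory.Transcendental.KZ.of r})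

/-- item stmt-KontsevichZagierPeriods-2669 · crux · rank 4 · open · by planner
why it might fail: At least summit-strength (all strength barriers apply); a Dehn-type or functional-transcendence invariant of stable piecewise-Nash volume-preserving equidecomposability finer than volume would kill it; Blass–Schanuel deem the SA-sets-mod-null classification intractable.
sources: CressonViusos2022, KontsevichZagier2001, ViuSos2021, Zakharevich2016
[crux][thesis X] STABLE SET TRANSPORT — Conjecture 1 in Monge form = Cresson–Viu-Sos Problem 2.1
('is vol : K₀(𝒞SA) → ℝ injective?') sharpened to ONE map and stabilised by free dimensions: two
integrand-1 representations of one dimension with equal value (= two ℚ-semialgebraic sets of equal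
finite volume; different dimensions are first equalised by slabs) become, after × [0,1]^M and
removal of null ℚ-SA subsets, source and target of a single rule-(2) move (piecewise-Nash, |det| =
1). 'Hilbert's third problem for ℚ-semialgebraic sets with curved scissors': volume is the only
invariant. Implies the summit (Assembly) and StableSAZylev (soundness); conversely
KontsevichZagierPeriods ∧ StableSAZylev ⟹ X, so X ⟺ summit ∧ SA-Zylev and any refutation of X by a
KZ-equivalent pair is a refutation of StableSAZylev, not of the summit. Calibrations: KZ's proof of
ζ(2) = π²/6 (KZ2001 §1.2: I = ∫∫ dxdy/((1−xy)√(xy)) = π²/2 by one algebraic change of variables +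
symmetry) is a transport; polytope sector = PolytopeTransport (known, M = 0); finite-volume
unbounded sets compactify by rule (2) ((x,u) ↦ (1/x, u x²) has |det| = 1); dimension-1 DENSITY pairs
need M = 1 (DimOneTransportFails) and get it b -/
@[route_item "route-KontsevichZagierPeriods-ScissorsTransport", crux]
def StableSetTransport : Prop :=
  ∀ ⦃N : ℕ⦄ (r r' : Literature.NumberTheory.Transcendental.KZ.IntegralRep N), (∀ x ∈ r.domain, r.integrand x = 1) → (∀ x ∈ r'.domain, r'.integrand x = 1) → r.value = r'.value → ∃ (M : ℕ) (s s' : Literature.NumberTheory.Transcendental.KZ.IntegralRep (N + M)), s.domain ⊆ {z | (fun i : Fin N => z (Fin.castAdd M i)) ∈ r.domain ∧ ∀ j : Fin M, z (Fin.natAdd N j) ∈ Set.Icc (0:ℝ) 1} ∧ MeasureTheory.volume ({z : Fin (N + M) → ℝ | (fun i : Fin N => z (Fin.castAdd M i)) ∈ r.domain ∧ ∀ j : Fin M, z (Fin.natAdd N j) ∈ Set.Icc (0:ℝ) 1} \ s.domain) = 0 ∧ s'.domain ⊆ {z | (fun i : Fin N => z (Fin.castAdd M i)) ∈ r'.domain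 ∧ ∀ j : Fin M, z (Fin.natAdd N j) ∈ Set.Icc (0:ℝ) 1} ∧ MeasureTheory.volume ({z : Fin (N + M) → ℝ | (fun i : Fin N => z (Fin.castAdd M i)) ∈ r'.domain ∧ ∀ j : Fin M, z (Fin.natAdd N j) ∈ Set.Icc (0:ℝ) 1} \ s'.domain) = 0 ∧ (∀ z ∈ s.domain, s.integrand z = 1) ∧ (∀ z ∈ s'.domain, s'.integrand z = 1) ∧ Literature.NumberTheory.Transcendental.KZ.of s - Literature.NumberTheory.Transcendental.KZ.of s' ∈ Literature.NumberTheory.Transcendental.KZ.changeOfVariablesRel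

-- earlier PolytopeTransport (stmt-KontsevichZagierPeriods-2672, replaced 2026-08-15T16:24:28Z -> stmt-KontsevichZagierPeriods-10815): retired by None — ∀ ⦃d : ℕ⦄ (P Q : Set (Fin d → ℝ)), Literature.Barriers.KontsevichZagierPeriods.PL.IsRationalPolyhedron P → Literature.Barriers.KontsevichZagierPeriods.PL.IsRationalPolyhedron Q → MeasureTheory.volume P = MeasureTheory.volume Q → ∃ (s s' : Literature.
/-- item stmt-KontsevichZagierPeriods-10815 · support · rank 9 · open · by planner
sources: CressonViusos2022, doi:10.1007/bf02566410
[support][known sector] For compact RATIONAL POLYHEDRA P, Q ⊂ ℝᵈ — finite unions of rational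
simplices, i.e. of convex hulls `convexHull ℝ (range v)` of affinely independent families v of
points with rational coordinates (rev 1: the barrier file's `PL.IsRationalPolyhedron` /
`IsRationalSimplex` INLINED over Mathlib, `Iff.rfl`-equal to the rev-0 statement, so that the route
no longer imports Literature.Barriers.KontsevichZagierPeriods.HauptvermutungObstruction and its XL
unproved fact cressonViuSos_prop_3_2) — of equal volume, full-measure ℚ-SA subsets are related by
ONE rule-(2) move with integrand 1, no stabilisation: cut both into convex rational pieces with
pairwise equal (rational) volumes (rational hyperplane cuts realise any rational volume split), map
piece to piece by Henriques–Pak rational volume-preserving PL homeomorphisms ('Monge maps' in Pak's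
sense), and observe that a finite chain of scissors congruences and PL maps composes to one
piecewise-affine bijection modulo the null cut loci (pieces open ⇒ HasFDerivWithinAt is local;
images disjoint ⇒ InjOn; affine pieces are ℚ-semialgebraic). d ≤ 1 trivial; d = 2 by Pak's explicit
vertex-shifting; general d rests on Moser's -/
@[route_item "route-KontsevichZagierPeriods-ScissorsTransport"]
def PolytopeTransport : Prop :=
  ∀ ⦃d : ℕ⦄ (P Q : Set (Fin d → ℝ)), (∃ (n : ℕ) (σ : Fin n → Set (Fin d → ℝ)), (∀ i, ∃ (k : ℕ) (v : Fin (k + 1) → (Fin d → ℝ)), AffineIndependent ℝ v ∧ (∀ a b, ∃ q : ℚ, v a b = (q : ℝ)) ∧ σ i = convexHull ℝ (Set.range v)) ∧ P = ⋃ i, σ i) → (∃ (n : ℕ) (σ : Fin n → Set (Fin d → ℝ)), (∀ i, ∃ (k : ℕ) (v : Fin (k + 1) → (Fin d → ℝ)), AffineIndependent ℝ v ∧ (∀ a b, ∃ q : ℚ, v a b = (q : ℝ)) ∧ σ i = convexHull ℝ (Set.range v)) ∧ Q = ⋃ i, σ i) → MeasureTheory.volume P = MeasureTheory.volume Q → ∃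 (s s' : Literature.NumberTheory.Transcendental.KZ.IntegralRep d), s.domain ⊆ P ∧ MeasureTheory.volume (P \ s.domain) = 0 ∧ s'.domain ⊆ Q ∧ MeasureTheory.volume (Q \ s'.domain) = 0 ∧ (∀ z ∈ s.domain, s.integrand z = 1) ∧ (∀ z ∈ s'.domain, s'.integrand z = 1) ∧ Literature.NumberTheory.Transcendental.KZ.of s - Literature.NumberTheory.Transcendental.KZ.of s' ∈ Literature.NumberTheory.Transcendental.KZ.changeOfVariablesRel

/-- item stmt-KontsevichZagierPeriods-10816 · support · rank 9 · open · by planner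
sources: KontsevichZagier2001, ViuSos2021
[support][glue, provable now] StableSetTransport → VolumeForm: the move bookkeeping that turns ONE
stabilised transport into a KZ-equivalence. Given integrand-1 representations r, r′ of dimension N
with equal value, StableSetTransport supplies M and integrand-1 representations s, s′ of dimension N
+ M, of full measure inside the cylinders cyl r = {z | (fun i => z (Fin.castAdd M i)) ∈ r.domain ∧ ∀
j, z (Fin.natAdd N j) ∈ [0,1]} and cyl r′, with of s − of s′ ∈ changeOfVariablesRel ⊆ relations. It
remains to show of r − of s ∈ relations (likewise for r′) and to compose: (i) the M-fold iterate R_M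
of the slab move at level 0 (R₀ = r, R_{k+1} = R_k.slab 0 : IntegralRep (N + k + 1); the types N +
(k+1) and (N + k) + 1 agree by rfl) satisfies of r − of R_M ∈ relations
(of_slab_sub_of_mem_newtonLeibnizRel, M times), has integrand 1 on its domain (integrand ∘
Fin.init), and its domain is EQUAL to cyl r — one Fin identity, proved once: Fin.castSucc
(Fin.castAdd k i) = Fin.castAdd (k+1) i and the new last coordinate is Fin.natAdd N (Fin.last k)
(Fin.ext); (ii) null removal: of R_M − of s ∈ relations by of_sub_of_mem_relations_of_null
(KZSemiCanonicalReductionProofs.lean; s.domain ⊆ cyl r, vol -/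
@[route_item "route-KontsevichZagierPeriods-ScissorsTransport"]
def CylinderReduction : Prop :=
  ∀ ⦃N M : ℕ⦄ (r : Literature.NumberTheory.Transcendental.KZ.IntegralRep N) (s : Literature.NumberTheory.Transcendental.KZ.IntegralRep (N + M)), (∀ x ∈ r.domain, r.integrand x = 1) → s.domain ⊆ {z | (fun i : Fin N => z (Fin.castAdd M i)) ∈ r.domain ∧ ∀ j : Fin M, z (Fin.natAdd N j) ∈ Set.Icc (0:ℝ) 1} → MeasureTheory.volume ({z : Fin (N + M) → ℝ | (fun i : Fin N => z (Fin.castAdd M i)) ∈ r.domain ∧ ∀ j : Fin M, z (Fin.natAdd N j) ∈ Set.Icc (0:ℝ) 1} \ s.domain) = 0 → (∀ z ∈ s.domain, s.integrand z = 1) → Literature.NumberTheory.Transcendental.KZ.Equivalent r s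

/-- item stmt-KontsevichZagierPeriods-2670 · support · rank 9 · closed · proved by Summit.KontsevichZagierPeriods.ScissorsTransport.DifferenceOfVolumes_proof @ 6e015c1b040b (prover) · by planner
sources: ViuSos2021, CressonViusos2022
[support] Every representation [σ, f] (dimension n) is, modulo the moves, a difference [U₊] − [U₋]
of two INTEGRAND-1 representations in dimension n + 1: split σ by the sign of f (1a twice; {f > 0},
{f < 0} are ℚ-SA by isSemialgebraic_sep_lt / tarski_seidenberg_real_holds), [σ₀, f] = [σ₀, 0] ≡ 0
(1b), the closed subgraph bands U± = {(x,t) : x ∈ σ±, 0 ≤ t ≤ ±f x} with integrand 1 are each ONE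
Newton–Leibniz move with primitive F = t, a = 0, b = ±f (pattern of graphRep /
of_slab_sub_of_mem_newtonLeibnizRel in KZCalculusProofs.lean; vol U± = ∫ f± < ∞), and [σ₋, f] =
−[σ₋, −f] by 1b. This is Viu-Sos's semi-canonical reduction (every real period is a difference of
volumes of ℚ-SA sets) performed inside the H21 rules (compactness not needed: finite volume
suffices); first half of the Assembly and the bridge r ↦ [U₊] − [U₋] to Cresson–Viu-Sos's K₀(𝒞SA).
Known; provable now (≈ 300 lines). [difficulty: provable-now] Sources: ViuSos2021 Thm 1.1;
CressonViusos2022 §2.2; KZCalculusProofs.lean (graphRep, slab). -/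
@[route_item "route-KontsevichZagierPeriods-ScissorsTransport"]
def DifferenceOfVolumes : Prop :=
  ∀ ⦃n : ℕ⦄ (r : Literature.NumberTheory.Transcendental.KZ.IntegralRep n), ∃ (s s' : Literature.NumberTheory.Transcendental.KZ.IntegralRep (n + 1)), (∀ z ∈ s.domain, s.integrand z = 1) ∧ (∀ z ∈ s'.domain, s'.integrand z = 1) ∧ Literature.NumberTheory.Transcendental.KZ.of r - (Literature.NumberTheory.Transcendental.KZ.of s - Literature.NumberTheory.Transcendental.KZ.of s') ∈ Literature.NumberTheory.Transcendental.KZ.relations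

-- `DifferenceOfVolumes` holds: proved by `Summit.KontsevichZagierPeriods.ScissorsTransport.DifferenceOfVolumes_proof` @ 6e015c1b040b (its module imports this route file, so no `_holds` link can be stated here).

/-- item stmt-KontsevichZagierPeriods-2671 · support · rank 9 · closed · proved by Summit.KontsevichZagierPeriods.ScissorsTransport.dimOneTransportFails_proof (prover) · by planner
sources: KontsevichZagier2001, CressonViusos2022
[support][negative fact] STABILISATION IS NECESSARY. Witness (triage refuter of card
newton-leibniz-is-a-shear, 2026-08-15): r = [(0,1), 1], r′ = [(1,2), 1 + 1/x − 1/(3 − x)]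
(KZ-rational, integrand ≥ 1/2, both values 1). They are KZ-equivalent by four honest moves (1b
twice; the change of variables y = 3 − x turns [(1,2), −1/(3−x)] into [(1,2), −1/y], which cancels
[(1,2), 1/x] by 1b + zero bookkeeping; a translation), yet for NO full-measure ℚ-SA restrictions s ⊆
r, s′ ⊆ r′ is of s − of s′ a change-of-variables move: s.domain is (0,1) minus finitely many points,
on each Nash piece a transport Φ with 1 = r′.integrand(Φ x)|Φ′ x| integrates to ±x + c = G(Φ x),
G(y) = y + log y + log(3 − y), so log(w) is Nash for the non-constant Nash function w = Φ(3 − Φ) and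
log would be semialgebraic on an interval — impossible (one-variable technique of
Literature.Barriers.KontsevichZagierPeriods.noSemialgebraicPrimitive_inv_sub_two_holds); s ≠ s′
since the domains differ, so membership would force exactly this Φ. KZ's own π-pair 2∫√(1−x²) =
∫(1−x²)^{−1/2} is a second witness (card level-pairing-no-transport-dim-one, arcsin obstruction; not
duplicated here). Records that the same-dimension / dens -/
@[route_item "route-KontsevichZagierPeriods-ScissorsTransport"]
def DimOneTransportFails : Prop :=
  ∃ (r r' : Literature.NumberTheory.Transcendental.KZ.IntegralRep 1), r.IsRational ∧ r'.IsRational ∧ (∀ x ∈ r.domain, 0 < r.integrand x) ∧ (∀ x ∈ r'.domain, 0 < r'.integrand x) ∧ Literature.NumberTheory.Transcendental.KZ.Equivalent r r' ∧ ∀ (s s' : Literature.NumberTheory.Transcendental.KZ.IntegralRep 1), s.domain ⊆ r.domain → MeasureTheory.volume (r.domain \ s.domain) = 0 → Set.EqOn s.integrand r.integrand s.domain → s'.domain ⊆ r'.domain → MeasureTheory.volume (r'.domain \ s'.domain) = 0 → Set.EqOn s'.integrand r'.integrand s'.domain → Literature.NumberTheory.Transcendental.KZ.of s - Literature.NumberTheory.Transcendental.KZ.of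 s' ∉ Literature.NumberTheory.Transcendental.KZ.changeOfVariablesRel

-- `DimOneTransportFails` holds: proved by `Summit.KontsevichZagierPeriods.ScissorsTransport.dimOneTransportFails_proof` (its module imports this route file, so no `_holds` link can be stated here).

/-- item stmt-KontsevichZagierPeriods-3814 · support · rank 9 · open · by planner
sources: CressonViusos2022, ViuSos2021, KontsevichZagier2001
[target] X — two integrand-1 integral representations of one dimension N with equal value are
KZ-equivalent (volume is the only KZ-invariant of finite-volume ℚ-semialgebraic sets);
summit-equivalent frame of the route, attacked here on the spherical sector. -/
@[route_item "route-KontsevichZagierPeriods-ScissorsTransport"]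
def VolumeForm : Prop :=
  ∀ ⦃N : ℕ⦄ (r r' : Literature.NumberTheory.Transcendental.KZ.IntegralRep N), (∀ x ∈ r.domain, r.integrand x = 1) → (∀ x ∈ r'.domain, r'.integrand x = 1) → r.value = r'.value → Literature.NumberTheory.Transcendental.KZ.Equivalent r r'

/-- item stmt-KontsevichZagierPeriods-2673 · assembly · rank 1 · closed · proved by Summit.KontsevichZagierPeriods.ScissorsTransport.Assembly_proof @ 2161bfde1b9e (prover) · by planner
sources: ViuSos2021, CressonViusos2022
[assembly] StableSetTransport → KontsevichZagierPeriods (the hypothesis is literally the text of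
crux StableSetTransport; `example : Assembly = (StableSetTransport → KontsevichZagierPeriods) :=
rfl` in Sketch.lean). Proof plan: given rational r, r′ with r.value = r′.value, DifferenceOfVolumes
gives [r] ≡ [U₊] − [U₋], [r′] ≡ [V₊] − [V₋] (integrand-1 reps); raise all four to a common dimension
by slabs (IntegralRep.exists_equivalent_of_le keeps integrand 1 ∘ init = 1) and glue A := U₊ ⊔ V₋, B
:= V₊ ⊔ U₋ at disjoint integer levels (IntegralRep.glue, of_glue_sub_sub_mem_domainAddRel,
disjoint_domain_slab_zero_two; glued integrand is 1 on the union); soundness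
(relations_le_ker_eval_holds) gives value A = value B; StableSetTransport yields s ⊆ cyl A, s′ ⊆ cyl
B of full measure with [s] − [s′] ∈ changeOfVariablesRel ⊆ relations; [cyl A] ≡ [A] by M slab moves
(the castAdd/natAdd cylinder is extensionally the M-fold iterate of slabDomain at level 0 — prove
this identity once), [cyl A] ≡ [s] by 1a with the null complement (cyl A = s.domain ∪ (cyl A ∖
s.domain), the second piece a null ℚ-SA set whose representation is ≡ 0 via σ = σ ∪ σ), likewise for
B; compose: [r] − [r′] ≡ [A] − [B] ≡ [s] -/
@[route_item "route-KontsevichZagierPeriods-ScissorsTransport", crux]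
def Assembly : Prop :=
  (∀ ⦃N : ℕ⦄ (r r' : Literature.NumberTheory.Transcendental.KZ.IntegralRep N), (∀ x ∈ r.domain, r.integrand x = 1) → (∀ x ∈ r'.domain, r'.integrand x = 1) → r.value = r'.value → ∃ (M : ℕ) (s s' : Literature.NumberTheory.Transcendental.KZ.IntegralRep (N + M)), s.domain ⊆ {z | (fun i : Fin N => z (Fin.castAdd M i)) ∈ r.domain ∧ ∀ j : Fin M, z (Fin.natAdd N j) ∈ Set.Icc (0:ℝ) 1} ∧ MeasureTheory.volume ({z : Fin (N + M) → ℝ | (fun i : Fin N => z (Fin.castAdd M i)) ∈ r.domain ∧ ∀ j : Fin M, z (Fin.natAdd N j) ∈ Set.Icc (0:ℝ) 1} \ s.domain) = 0 ∧ s'.domain ⊆ {z | (fun i : Fin N => z (Fin.castAdd M i)) ∈ r'.domain ∧ ∀ j : Fin M, z (Fin.natAdd N j) ∈ Set.Icc (0:ℝ) 1} ∧ MeasureTheory.volume ({z : Fin (N + M) → ℝ | (fun i : Fin N => z (Fin.castAdd M i)) ∈ r'.domain ∧ ∀ j : Fin M, z (Fin.natAdd N j) ∈ Set.Icc (0:ℝ)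 1} \ s'.domain) = 0 ∧ (∀ z ∈ s.domain, s.integrand z = 1) ∧ (∀ z ∈ s'.domain, s'.integrand z = 1) ∧ Literature.NumberTheory.Transcendental.KZ.of s - Literature.NumberTheory.Transcendental.KZ.of s' ∈ Literature.NumberTheory.Transcendental.KZ.changeOfVariablesRel) → KontsevichZagierPeriods

-- `Assembly` holds: proved by `Summit.KontsevichZagierPeriods.ScissorsTransport.Assembly_proof` @ 2161bfde1b9e (its module imports this route file, so no `_holds` link can be stated here).

-- records of items no longer active in this route (dropped / restated):
-- earlier Assembly2 (stmt-KontsevichZagierPeriods-3822, dropped 2026-08-16T14:43:06Z): proved by Summit.KontsevichZagierPeriods.VolumeFormAssembly.symplecticScissors_assembly_proof — VolumeForm → KontsevichZagierPeriods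

/-! D-0027 §2.1 — DECIDING THEOREM (planner-authored via `route open/edit --closes-file`; by planner-rbadge-KontsevichZagierPeriods-Scissor-31e79734-g2-0 2026-08-15T16:24:28Z):
its hypotheses are this route's items and its conclusion the sub-problem Statement (glue_lint), and it elaborates with this file. -/

@[closes "route-KontsevichZagierPeriods-ScissorsTransport"] theorem closes (h₁ : StableSetTransport) (h₂ : Assembly) : KontsevichZagierPeriods :=
  h₂ h₁

end Summit.KontsevichZagierPeriods.KontsevichZagierPeriods.Theses.ScissorsTransport
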